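import Summits.QuantumFields.YangMills.Theorems.BalabanUVNodesN11ChiPrimeFineOrbitAverageBound
import Summits.QuantumFields.YangMills.Theorems.BalabanUVNodesN11TopPairOldSideFineGaugeOrbitAverage
import Summits.QuantumFields.YangMills.Theorems.BalabanUVNodesN11TkNoExpansionSumTransportIntegrable
import Summits.QuantumFields.YangMills.Theorems.BalabanUVNodesN08HaarCompatibilityGuardHaarBall
import Literature.MathematicalPhysics.QuantumFieldTheory.Balaban1983to89.Node00.CubeRoughSection

/-!
# DAG node N11 — UNDER def-T's (†) THE ALL-SMALL-FIELD TERM OF (3.3) IS DOMINATED A.E. BY `C·Haar{|h − 1| < 2δ_k}^{#T}` TIMES THE TRANSPORT OF THE OLD DENSITY;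
# at the record (`SU(N)`, `avOfRecord`), with the SU(2) numeral `Haar{|h − 1| < 2δ} ≤ π²(2δ)³∕12`, and at the TOP PAIR of the Stage-13 record

HEADER — WORK-UNIT METADATA.  Cell `pub-ymgap`, YM-PLAN Track A (HUMAN RULING D-0062), R134 fan-out seat `pub-ymgap-dag-n11-e` (g32) on node N11 [B14]; route
`BalabanUVNodes`, key K1⁹ = stmt-QuantumFields-27364 (helper, `--kind proof --supports 27364 --as helper`, count-neutral).  [I] = [Balaban1987RG1], [III] = [Balaban1988Convergent].
Sibling of this seat's g32 `…N11ChiPrimeFineOrbitAverageBound` (the VOLUME BOUND on the uniform fine-gauge orbit average of (3.3)'s `χ′_k`: `[χ′_k(X)·w̃]^{av} ≤ C·v(2δ)^{#T}`,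
`v(r) := Haar{h : |h − 1| < r}`) and g31 `…N11TransportFineGaugeOrbitAverage` ∕ `…N11TopPairOldSideFineGaugeOrbitAverage` (the ORBIT-AVERAGE LAW of (†), generic ∕ record ∕
top-pair editions) — BY NAME; over dag-n11-d's `…N11TkNoExpansionSumTransportIntegrable` (`ae_integrable_section_of_integrable_graph`: fibrewise integrability at the record),
dag-n08-w3's `…N08HaarCompatibilityGuardHaarBall` (`haar_dist1_lt_le`: `Haar_{SU(2)}{|U − 1| < δ} ≤ π²δ³∕12`), def-T's `Node00/TStepOfRecord` (`transportOfRecord`), `DatumAvLayer`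
(`avOfRecord`, `rhoZeroOfRecord`), `StepWeightsOfRecord` (`sect3DataOfRecord`, `deltaOfRecord`, `IsZetaAbsLeOne`), `Record12ResidualsSlots` (`measurable_rhoZeroOfRecord`),
dag-n13's `integrable_rhoZeroOfRecord`, dag-n11-d's `…N11TopPairNewAction` (the top pair's letters).

WHY.  The sibling bounds the WEIGHT def-T's (†) gives the all-small-field term of (3.3); this file turns the weight bound into a bound on the TERM: by g31's law
`∫dU δ(ŪV⁻¹)[f·ρ](V) = ∫dU δ(ŪV⁻¹)[f^{av}·ρ](V)` a.e., and on each fibre of positive marginal density along which `ρ ≥ 0` is integrable the kernel integral is monotone, so an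
orbit-average bound `|f^{av}| ≤ a` gives `|∫dU δ(ŪV⁻¹)[f(·,V)ρ](V)| ≤ a·∫dU δ(ŪV⁻¹)[ρ](V)` for a.e. `V` (§1).  At the record the fibrewise integrability is dag-n11-d's
`ae_integrable_section_of_integrable_graph` (§2); at `N = 2` the Haar volume is a number, `v(2δ) ≤ π²(2δ)³∕12` for `2δ ≤ 1` (dag-n08-w3), so one block comb inside a cube costs
`(π²(2δ)³∕12)^{L^d − 1}` (§3); at the TOP PAIR `(Ω₁,Λ₁) = (𝕋,𝕋)` of the Stage-13 record the OLD side of dag-n11-d's `firstStep_O3_top_iff_explicit`,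
`∫dU δ(ŪV′⁻¹)[χ′_0(ALL)·Σ_Sζ_1(∅,∅,(∅,S))·ρ₀](V′)`, is therefore at most `v(2δ₀)^{#T}·∫dU δ(ŪV′⁻¹)[ρ₀](V′)` in absolute value for a.e. `V′`, for every centre-avoiding tree `T`
of level-0 bonds read by the (3.3) cubes of record and every residual obeying the record's row `IsZetaAbsLeOne` (§4) — whatever new side the identity displays must be that small.
Print's term is read after (1.5)⇒(1.6) ([III] p.265 L.8–12) and is the leading term ([I] Thm 1, (0.19)–(0.25)).  A READING for the type owner (node00-def-T) and the K-lanes,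
with kernel certificates; nothing landed is edited; g31's (R1)∕(R2)∕(R3) remain theirs to rule.

WHAT THIS FILE PROVES (0 `def`, 0 `sorry`, standard axioms).
§1 generic (`RegularGaugeGroup`, standard Borel; `Ū` measurable, `HaarAC`, fine-gauge invariant; `ρ ≥ 0` fine-gauge-invariant integrable; DISPLAYED row `hfib`: `ρ` integrable along
   a.e. fibre of positive marginal density): ★★★ `abs_transportK_family_mul_le_ae` (orbit-average bound `a` ⟹ term bound `a·∫dU δ(ŪV⁻¹)[ρ]` a.e.) ·
   ★★★ `abs_transportK_chiPrime_mul_le_ae` (`|∫dU δ(ŪV⁻¹)[χ′_k(X)(·,V)·w̃(·,V)·ρ](V)| ≤ C·v(2δ)^{#T}·∫dU δ(ŪV⁻¹)[ρ](V)` a.e., `T` any centre-avoiding tree read by `X`).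
§2 record (`SU(N)`, `k < K`, `avOfRecord`, `transportOfRecord`): `ae_integrable_fibre_of_record` (row `hfib` BY NAME from dag-n11-d) · ★★★ `abs_transportOfRecord_family_mul_le_ae` ·
   ★★★ `abs_transportOfRecord_chiPrime_mul_le_ae`.
§3 the SU(2) numeral: `toReal_haar_dist1_lt_le_su2` (`v(r) ≤ π²r³∕12`, `0 ≤ r ≤ 1`) · ★★ `integral_chiPrime_fineOrbit_le_pow_su2` (`[χ′_k(X)]^{av} ≤ (π²(2δ)³∕12)^{#T}`) ·
   ★★ `integral_chiPrime_fineOrbit_le_pow_blockComb_su2` (`≤ (π²(2δ)³∕12)^{L^d − 1}`).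
§4 top pair of the Stage-13 record (`0 < K`, length-1 history; displayed rows: joint measurability of the weight (def-T (O4)), `IsZetaAbsLeOne` of the residual (the record's
   proviso row `zetaAbs`), a centre-avoiding tree `T` read by the (3.3) cubes of record): `abs_sum_zeta_le_one` · ★★★ `abs_firstStep_oldSide_le_ae`
   (`|old side(V′)| ≤ v(2δ₀)^{#T} · transportOfRecord 0 ρ₀ V′` for a.e. `V′`).

HONEST FRAMING.  Helper lane of K1⁹, count-neutral; [folklore] measure theory composed BY NAME with landed bookkeeping and two landed numerals; UPPER BOUNDS on quantities of
def-T's typed objects — nothing of Bałaban's ESTIMATES asserted, no identity of print asserted or refuted; (O3′) ∕ Thm 1 ∕ Thm 2 NOT touched; K1⁹'s `∃θ` NOT refuted; N11 NOT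
discharged; K1⁹ NOT closed; counts unmoved (typed 28∕28 · discharged 6∕28).  One finite four-torus programme at fixed `ε = L^{−K}` — NOT ℝ⁴, NOT OS, NOT a mass gap, NOT Clay.
No `sorry`, `axiom`, `def`, `instance`, `notation`.  Sources (SHAPE ∕ bookkeeping only): [III] (1.5)–(1.6) p.247, (3.1) p.264, (3.3)–(3.4) p.265 with L.8–12, (3.16) p.268,
(3.25) p.270, Thm 1 p.262; [I] (0.13)–(0.16) pp.254–255, (0.19)–(0.25) pp.255–257, Thm 1 p.259; [Balaban1985UV3] p.260 (the SU(2) Haar density).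
-/

noncomputable section
open MeasureTheory Function
open scoped ENNReal BigOperators

namespace Summit.QuantumFields.YangMills.Theorems.BalabanUVNodesN11ChiPrimeFineOrbitAverageBoundTransport

open Literature.MathematicalPhysics.QuantumFieldTheory.Balaban1983to89
open GaugeField (gaugeAct)
open T4AveragingDisintegration (kernelTransport transportK margDensity condLaw)
open T4FiniteEpsInhabited (HaarAC)
open T4AxialGaugeFixing (TreeOrder combBonds)
open B12FaddeevPopov016 (FineGauge FineGaugeInvariant FPIdx fineTransf)
open B14.Sect3Decomp (Sect3Data chiPrime Vbox)
open BalabanUVNodesN11TransportFineGaugeOrbitAverage (transportK_family_mul_ae_eq_fineOrbitAvg fineGaugeInvariant_rhoZeroOfRecord)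
open BalabanUVNodesN11ChiPrimeFineOrbitAverageBound

/-! ## §1  Generic: an orbit-average bound on a factor bounds its term under (†) by the transport of the density -/

section Generic

variable {P : Params} {j : ℕ} {G : Type*} [GaugeGroup G] [MeasurableSpace G] [HaarData G] [RegularGaugeGroup G] [StandardBorelSpace G]

/-- ★★★ **AN ORBIT-AVERAGE BOUND ON A FACTOR BOUNDS ITS TERM UNDER (†) BY THE TRANSPORT OF THE DENSITY.**  Along an averaging `Ū` (measurable, `HaarAC`, invariant under the
fine gauge group), for `ρ ≥ 0` fine-gauge-invariant integrable and integrable along a.e. fibre of positive marginal density (row `hfib`), and a bounded jointly measurable factor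
`f(U,V)` whose UNIFORM fine-gauge orbit average obeys `|∫∏dg f(U^{u_g},V)| ≤ a` at every `(U,V)`:
`|∫dU δ(ŪV⁻¹)[f(·,V)·ρ](V)| ≤ a · ∫dU δ(ŪV⁻¹)[ρ](V)` for `dV`-a.e. `V` (g31's orbit-average law, then monotonicity of the fibre integral).
[cite: Balaban1988Convergent, (3.1) p.264, (1.5)–(1.6) p.247; Balaban1987RG1, (0.13)–(0.16) pp.254–255] -/
theorem abs_transportK_family_mul_le_ae (hj : j + 1 ≤ P.m + P.K) {avg : GaugeField P j G → GaugeField P (j + 1) G}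
    (havg : Measurable avg) (hac : HaarAC avg) (havgInv : ∀ u : GaugeTransf P j G, FineGauge u → ∀ U, avg (gaugeAct u U) = avg U)
    {ρ : Density P j G} (hρ : FineGaugeInvariant ρ) (hρi : Integrable ρ (fieldMeasure P j G)) (hρ0 : ∀ U, 0 ≤ ρ U)
    (hfib : ∀ᵐ V ∂fieldMeasure P (j + 1) G, margDensity (fieldMeasure P j G) (fieldMeasure P (j + 1) G) avg V ≠ 0 →
      Integrable ρ (condLaw (fieldMeasure P j G) avg V))
    {f : GaugeField P j G → GaugeField P (j + 1) G → ℝ} (hfm : Measurable fun p : GaugeField P j G × GaugeField P (j + 1) G => f p.1 p.2)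
    {C : ℝ} (hfb : ∀ U V, |f U V| ≤ C) {a : ℝ}
    (hav : ∀ U V, |∫ g, f (gaugeAct (fineTransf g) U) V ∂Measure.pi (fun _ : FPIdx P j => (HaarData.haar : Measure G))| ≤ a) :
    ∀ᵐ V ∂fieldMeasure P (j + 1) G, |transportK avg (fun U => f U V * ρ U) V| ≤ a * transportK avg ρ V := by
  have h1 := transportK_family_mul_ae_eq_fineOrbitAvg hj havg hac havgInv hρ hρi hfm hfb
  filter_upwards [h1, hfib] with V hV hfibV
  rw [hV]
  by_cases hmd : margDensity (fieldMeasure P j G) (fieldMeasure P (j + 1) G) avg V = 0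
  · simp [transportK, kernelTransport, hmd]
  · have hint := hfibV hmd
    simp only [transportK, kernelTransport]
    rw [abs_mul, abs_of_nonneg (NNReal.coe_nonneg _)]
    have hI : |∫ U, (∫ g, f (gaugeAct (fineTransf g) U) V ∂Measure.pi (fun _ : FPIdx P j => (HaarData.haar : Measure G))) * ρ U
          ∂condLaw (fieldMeasure P j G) avg V| ≤
        ∫ U, a * ρ U ∂condLaw (fieldMeasure P j G) avg V :=
      calc |∫ U, (∫ g, f (gaugeAct (fineTransf g) U) V ∂Measure.pi (fun _ : FPIdx P j => (HaarData.haar : Measure G))) * ρ U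
              ∂condLaw (fieldMeasure P j G) avg V|
          ≤ ∫ U, |(∫ g, f (gaugeAct (fineTransf g) U) V ∂Measure.pi (fun _ : FPIdx P j => (HaarData.haar : Measure G))) * ρ U|
              ∂condLaw (fieldMeasure P j G) avg V := abs_integral_le_integral_abs
        _ ≤ ∫ U, a * ρ U ∂condLaw (fieldMeasure P j G) avg V :=
            integral_mono_of_nonneg (ae_of_all _ fun U => abs_nonneg _) (hint.const_mul a) (ae_of_all _ fun U => by
              show |_ * ρ U| ≤ a * ρ U
              rw [abs_mul, abs_of_nonneg (hρ0 U)]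
              exact mul_le_mul_of_nonneg_right (hav U V) (hρ0 U))
    calc (margDensity (fieldMeasure P j G) (fieldMeasure P (j + 1) G) avg V : ℝ) *
          |∫ U, (∫ g, f (gaugeAct (fineTransf g) U) V ∂Measure.pi (fun _ : FPIdx P j => (HaarData.haar : Measure G))) * ρ U
            ∂condLaw (fieldMeasure P j G) avg V|
        ≤ (margDensity (fieldMeasure P j G) (fieldMeasure P (j + 1) G) avg V : ℝ) * ∫ U, a * ρ U ∂condLaw (fieldMeasure P j G) avg V :=
          mul_le_mul_of_nonneg_left hI (NNReal.coe_nonneg _)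
      _ = a * ((margDensity (fieldMeasure P j G) (fieldMeasure P (j + 1) G) avg V : ℝ) * ∫ U, ρ U ∂condLaw (fieldMeasure P j G) avg V) := by
          rw [integral_const_mul]; ring

variable [DecidableEq (PBond P j)]

/-- ★★★ **UNDER (†), THE ALL-SMALL-FIELD TERM IS DOMINATED BY `C·Haar{|h − 1| < 2δ}^{#T}` TIMES THE TRANSPORT OF THE OLD DENSITY.**  For a (3.3)∕(3.4) datum, a step weight
`χ′_k(X)(U,V)·w̃(U,V)` with `w̃` jointly measurable and `|w̃| ≤ C` (def-T's `wOfRecord` at `Q_{k+1} = ∅` has this shape: `χ_{k+1}`-factors of `V`, `χ′_k` of every cube, the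
residual `ζ`), `ρ ≥ 0` fine-gauge-invariant integrable with row `hfib`, and a bond set `T` with a centre-avoiding peeling order read by cubes of `X`:
`|∫dU δ(ŪV⁻¹)[χ′_k(X)(·,V)·w̃(·,V)·ρ](V)| ≤ C·Haar{|h − 1| < 2δ}^{#T} · ∫dU δ(ŪV⁻¹)[ρ](V)` for `dV`-a.e. `V`.  With one block comb per cube the factor is
`Haar{…}^{|cubes|·(L^d − 1)}`: the term def-T's (†) designates as the small-field term is volume-suppressed against the full transport — it is not a leading term.
[cite: Balaban1988Convergent, (3.1) p.264, (3.3)–(3.4) p.265 with L.8–12, (3.16) p.268, (3.25) p.270; Balaban1987RG1, (0.13)–(0.16) pp.254–255, (0.19) p.255] -/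
theorem abs_transportK_chiPrime_mul_le_ae (hj : j + 1 ≤ P.m + P.K) {avg : GaugeField P j G → GaugeField P (j + 1) G}
    (havg : Measurable avg) (hac : HaarAC avg) (havgInv : ∀ u : GaugeTransf P j G, FineGauge u → ∀ U, avg (gaugeAct u U) = avg U)
    {ρ : Density P j G} (hρ : FineGaugeInvariant ρ) (hρi : Integrable ρ (fieldMeasure P j G)) (hρ0 : ∀ U, 0 ≤ ρ U)
    (hfib : ∀ᵐ V ∂fieldMeasure P (j + 1) G, margDensity (fieldMeasure P j G) (fieldMeasure P (j + 1) G) avg V ≠ 0 →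
      Integrable ρ (condLaw (fieldMeasure P j G) avg V))
    (D : Sect3Data P G j) (av : ∀ i, Averaging P i G) (twoδ : ℝ) (X : Finset D.Cube1)
    {T : Finset (PBond P j)} {v : PBond P j → Site P j} {r : Site P j → ℕ} (hT : TreeOrder T v r)
    (hv : ∀ b ∈ T, ∀ y : Site P (j + 1), v b ≠ emb y) (cT : PBond P j → D.Cube1) (hcX : ∀ b ∈ T, cT b ∈ X)
    (hcb : ∀ b ∈ T, b ∈ D.bondsStar (cT b))
    {w : GaugeField P j G → GaugeField P (j + 1) G → ℝ}
    (hm : Measurable fun p : GaugeField P j G × GaugeField P (j + 1) G => chiPrime D av twoδ X p.1 p.2 * w p.1 p.2)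
    {C : ℝ} (hw : ∀ U V, |w U V| ≤ C) :
    ∀ᵐ V ∂fieldMeasure P (j + 1) G,
      |transportK avg (fun U => chiPrime D av twoδ X U V * w U V * ρ U) V| ≤
        C * ((HaarData.haar : Measure G) {h : G | dist1 h < twoδ}).toReal ^ T.card * transportK avg ρ V := by
  have hC : 0 ≤ C := (abs_nonneg _).trans (hw 1 1)
  have hfb : ∀ U V, |chiPrime D av twoδ X U V * w U V| ≤ C := fun U V => by
    rw [abs_mul, abs_of_nonneg (chiPrime_nonneg D av twoδ X U V)]
    calc chiPrime D av twoδ X U V * |w U V| ≤ 1 * C :=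
          mul_le_mul (chiPrime_le_one D av twoδ X U V) (hw U V) (abs_nonneg _) zero_le_one
      _ = C := one_mul C
  exact abs_transportK_family_mul_le_ae hj havg hac havgInv hρ hρi hρ0 hfib hm hfb
    (fun U V => abs_integral_chiPrime_mul_fineOrbit_le D av twoδ X V hT hv cT hcX hcb (w := fun Vk => w Vk V) (fun Vk => hw Vk V) U)

end Generic

/-! ## §2  At the record: `G = SU(N)`, def-T's `transportOfRecord F N K k` along `avOfRecord F N K k`, `k < K` -/

section Record

open T4Continuum (T4Family)
open Node00
open BalabanUVNodesN11TkNoExpansionSumTransportIntegrable (ae_integrable_section_of_integrable_graph)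

variable (F : T4Family) (N : ℕ) [NeZero N]

/-- The standing range `k + 1 ≤ m + K` of the `K`-th torus from `k < K` (bookkeeping). [folklore] -/
private theorem succ_le_m_add_K_of_lt {K k : ℕ} (hk : k < K) : k + 1 ≤ (F.P K).m + (F.P K).K := by
  simp only [T4Family.P_K, T4Family.P_m]; omega

/-- **ROW `hfib` AT THE RECORD, BY NAME**: a measurable integrable density of the level-`k` field is integrable along the averaging kernel of record for `dV′`-a.e. `V′` of
positive marginal density (dag-n11-d's `ae_integrable_section_of_integrable_graph` with a `V′`-independent integrand). [cite: Balaban1985Averaging, (10) p.19 (bookkeeping)] -/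
theorem ae_integrable_fibre_of_record {K k : ℕ} (hk : k < K) {ρ : Density (F.P K) k (SU N)} (hρm : Measurable ρ)
    (hρi : Integrable ρ (fieldMeasure (F.P K) k (SU N))) :
    ∀ᵐ V' ∂fieldMeasure (F.P K) (k + 1) (SU N),
      margDensity (fieldMeasure (F.P K) k (SU N)) (fieldMeasure (F.P K) (k + 1) (SU N)) (avOfRecord F N K k).avg V' ≠ 0 →
        Integrable ρ (condLaw (fieldMeasure (F.P K) k (SU N)) (avOfRecord F N K k).avg V') :=
  ae_integrable_section_of_integrable_graph F N K k hk (f := fun _ U => ρ U) (hρm.comp measurable_snd) hρi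

/-- ★★★ **AT THE RECORD: AN ORBIT-AVERAGE BOUND ON A FACTOR BOUNDS ITS TERM UNDER def-T's TRANSPORT.**  For `k < K`, `ρ ≥ 0` measurable, integrable and fine-gauge invariant,
and a bounded jointly measurable factor `f(U,V′)` with `|∫∏dg f(U^{u_g},V′)| ≤ a` at every `(U,V′)`:
`|transportOfRecord k (f(·,V′)·ρ) V′| ≤ a · transportOfRecord k ρ V′` for `dV′`-a.e. `V′`. [cite: Balaban1988Convergent, (3.1) p.264, (1.5)–(1.6) p.247; Balaban1987RG1, (0.13)–(0.16) pp.254–255] -/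
theorem abs_transportOfRecord_family_mul_le_ae {K k : ℕ} (hk : k < K)
    {ρ : Density (F.P K) k (SU N)} (hρ : FineGaugeInvariant ρ) (hρm : Measurable ρ) (hρi : Integrable ρ (fieldMeasure (F.P K) k (SU N)))
    (hρ0 : ∀ U, 0 ≤ ρ U)
    {f : GaugeField (F.P K) k (SU N) → GaugeField (F.P K) (k + 1) (SU N) → ℝ}
    (hfm : Measurable fun p : GaugeField (F.P K) k (SU N) × GaugeField (F.P K) (k + 1) (SU N) => f p.1 p.2) {C : ℝ} (hfb : ∀ U V, |f U V| ≤ C)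
    {a : ℝ} (hav : ∀ U V, |∫ g, f (gaugeAct (fineTransf g) U) V ∂Measure.pi (fun _ : FPIdx (F.P K) k => (HaarData.haar : Measure (SU N)))| ≤ a) :
    ∀ᵐ V ∂fieldMeasure (F.P K) (k + 1) (SU N), |transportOfRecord F N K k (fun U => f U V * ρ U) V| ≤ a * transportOfRecord F N K k ρ V :=
  abs_transportK_family_mul_le_ae (succ_le_m_add_K_of_lt F hk) (avOfRecord_measurable F N K k) (avOfRecord_haarAC F N K k hk)
    (fun _ hu U => avOfRecord_gaugeAct_of_fineGauge F N hk hu U) hρ hρi hρ0 (ae_integrable_fibre_of_record F N hk hρm hρi) hfm hfb hav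

/-- ★★★ **AT THE RECORD: THE ALL-SMALL-FIELD TERM IS DOMINATED BY `C·Haar{|h − 1| < 2δ}^{#T}` TIMES THE TRANSPORT OF THE OLD DENSITY.**  For `k < K`, any (3.3)∕(3.4) datum on
the `K`-th torus, a weight `χ′_k(X)·w̃` with `w̃` jointly measurable and `|w̃| ≤ C`, `ρ ≥ 0` measurable integrable fine-gauge invariant, and a centre-avoiding tree `T` read by cubes of `X`:
`|transportOfRecord k (χ′_k(X)(·,V′)·w̃(·,V′)·ρ) V′| ≤ C·Haar{|h − 1| < 2δ}^{#T} · transportOfRecord k ρ V′` for `dV′`-a.e. `V′`.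
[cite: Balaban1988Convergent, (3.1) p.264, (3.3)–(3.4) p.265 with L.8–12, (3.25) p.270; Balaban1987RG1, (0.13)–(0.16) pp.254–255, (0.19) p.255] -/
theorem abs_transportOfRecord_chiPrime_mul_le_ae {K k : ℕ} (hk : k < K) [DecidableEq (PBond (F.P K) k)]
    {ρ : Density (F.P K) k (SU N)} (hρ : FineGaugeInvariant ρ) (hρm : Measurable ρ) (hρi : Integrable ρ (fieldMeasure (F.P K) k (SU N)))
    (hρ0 : ∀ U, 0 ≤ ρ U) (D : Sect3Data (F.P K) (SU N) k) (av : ∀ i, Averaging (F.P K) i (SU N)) (twoδ : ℝ) (X : Finset D.Cube1)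
    {T : Finset (PBond (F.P K) k)} {v : PBond (F.P K) k → Site (F.P K) k} {r : Site (F.P K) k → ℕ} (hT : TreeOrder T v r)
    (hv : ∀ b ∈ T, ∀ y : Site (F.P K) (k + 1), v b ≠ emb y) (cT : PBond (F.P K) k → D.Cube1) (hcX : ∀ b ∈ T, cT b ∈ X)
    (hcb : ∀ b ∈ T, b ∈ D.bondsStar (cT b))
    {w : GaugeField (F.P K) k (SU N) → GaugeField (F.P K) (k + 1) (SU N) → ℝ}
    (hm : Measurable fun p : GaugeField (F.P K) k (SU N) × GaugeField (F.P K) (k + 1) (SU N) => chiPrime D av twoδ X p.1 p.2 * w p.1 p.2)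
    {C : ℝ} (hw : ∀ U V, |w U V| ≤ C) :
    ∀ᵐ V ∂fieldMeasure (F.P K) (k + 1) (SU N),
      |transportOfRecord F N K k (fun U => chiPrime D av twoδ X U V * w U V * ρ U) V| ≤
        C * ((HaarData.haar : Measure (SU N)) {h : SU N | dist1 h < twoδ}).toReal ^ T.card * transportOfRecord F N K k ρ V :=
  abs_transportK_chiPrime_mul_le_ae (succ_le_m_add_K_of_lt F hk) (avOfRecord_measurable F N K k) (avOfRecord_haarAC F N K k hk)
    (fun _ hu U => avOfRecord_gaugeAct_of_fineGauge F N hk hu U) hρ hρi hρ0 (ae_integrable_fibre_of_record F N hk hρm hρi) D av twoδ X hT hv cT hcX hcb hm hw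

end Record

/-! ## §3  The SU(2) numeral: `Haar_{SU(2)}{|h − 1| < 2δ} ≤ π²(2δ)³∕12` (dag-n08-w3), so one block comb costs `(π²(2δ)³∕12)^{L^d − 1}` -/

section SU2

open Node00 (SU)
open Summit.QuantumFields.YangMills.BalabanUVNodes.N08HaarCompatibilityGuardHaarBall (haar_dist1_lt_le haarData_haar_eq)

variable {P : Params} {j : ℕ}

/-- **THE HAAR VOLUME OF THE `dist1`-BALL OF `SU(2)` AS A REAL NUMBER**: `Haar{U : |U − 1| < r}.toReal ≤ π²r³∕12` for `0 ≤ r ≤ 1` (dag-n08-w3's `haar_dist1_lt_le` in the exponential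
chart, BY NAME). [cite: Balaban1985UV3, p.260 (the SU(2) Haar density; bookkeeping)] -/
theorem toReal_haar_dist1_lt_le_su2 {r : ℝ} (h0 : 0 ≤ r) (h1 : r ≤ 1) :
    ((HaarData.haar : Measure (SU 2)) {h : SU 2 | dist1 h < r}).toReal ≤ Real.pi ^ 2 * r ^ 3 / 12 := by
  rw [haarData_haar_eq]
  exact ENNReal.toReal_le_of_le_ofReal (by positivity) (haar_dist1_lt_le h0 h1)

/-- ★★ **AT `N = 2`: THE UNIFORM ORBIT AVERAGE OF (3.3)'s SMALL-FIELD FACTOR IS AT MOST `(π²(2δ)³∕12)^{#T}`** (`0 ≤ 2δ ≤ 1`; `T` any centre-avoiding tree read by cubes of `X`;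
every fine field `U`, every coarse field `V`). [cite: Balaban1988Convergent, (3.3)–(3.4) p.265; Balaban1985UV3, p.260 (bookkeeping)] -/
theorem integral_chiPrime_fineOrbit_le_pow_su2 [DecidableEq (PBond P j)] (D : Sect3Data P (SU 2) j) (av : ∀ i, Averaging P i (SU 2))
    {twoδ : ℝ} (h0 : 0 ≤ twoδ) (h1 : twoδ ≤ 1) (X : Finset D.Cube1) (V : GaugeField P (j + 1) (SU 2))
    {T : Finset (PBond P j)} {v : PBond P j → Site P j} {r : Site P j → ℕ} (hT : TreeOrder T v r)
    (hv : ∀ b ∈ T, ∀ y : Site P (j + 1), v b ≠ emb y) (cT : PBond P j → D.Cube1) (hcX : ∀ b ∈ T, cT b ∈ X)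
    (hcb : ∀ b ∈ T, b ∈ D.bondsStar (cT b)) (U : GaugeField P j (SU 2)) :
    ∫ g, chiPrime D av twoδ X (gaugeAct (fineTransf g) U) V ∂Measure.pi (fun _ : FPIdx P j => (HaarData.haar : Measure (SU 2))) ≤
      (Real.pi ^ 2 * twoδ ^ 3 / 12) ^ T.card :=
  (integral_chiPrime_fineOrbit_le_pow D av twoδ X V hT hv cT hcX hcb U).trans
    (pow_le_pow_left₀ ENNReal.toReal_nonneg (toReal_haar_dist1_lt_le_su2 h0 h1) _)

/-- ★★ **AT `N = 2`, ONE BLOCK COMB INSIDE A CUBE OF `X`: `[χ′_k(X)]^{av} ≤ (π²(2δ)³∕12)^{L^d − 1}`** at every `(U,V)` — e.g. `≤ ((π²∕12)(2δ)³)^{15}` at `L = 2`, `d = 4`.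
[cite: Balaban1988Convergent, (3.3)–(3.4) p.265; Balaban1987RG1, (0.16) p.255; Balaban1985UV3, p.260 (bookkeeping)] -/
theorem integral_chiPrime_fineOrbit_le_pow_blockComb_su2 [DecidableEq (PBond P j)] (hj : j + 1 ≤ P.m + P.K) (D : Sect3Data P (SU 2) j)
    (av : ∀ i, Averaging P i (SU 2)) {twoδ : ℝ} (h0 : 0 ≤ twoδ) (h1 : twoδ ≤ 1) (X : Finset D.Cube1) (V : GaugeField P (j + 1) (SU 2))
    {c : D.Cube1} (hc : c ∈ X) (y : Site P (j + 1))
    (hcomb : ∀ b ∈ (combBonds (fun κ => (((y κ).val * P.L : ℕ) : ℤ)) (fun κ => (((y κ).val * P.L + (P.L - 1) : ℕ) : ℤ)) : Finset (PBond P j)),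
      b ∈ D.bondsStar c) (U : GaugeField P j (SU 2)) :
    ∫ g, chiPrime D av twoδ X (gaugeAct (fineTransf g) U) V ∂Measure.pi (fun _ : FPIdx P j => (HaarData.haar : Measure (SU 2))) ≤
      (Real.pi ^ 2 * twoδ ^ 3 / 12) ^ (P.L ^ P.d - 1) :=
  (integral_chiPrime_fineOrbit_le_pow_blockComb hj D av twoδ X V hc y hcomb U).trans
    (pow_le_pow_left₀ ENNReal.toReal_nonneg (toReal_haar_dist1_lt_le_su2 h0 h1) _)

end SU2

/-! ## §4  THE TOP PAIR `(Ω₁, Λ₁) = (𝕋, 𝕋)` OF THE STAGE-13 RECORD: the old side of dag-n11-d's `firstStep_O3_top_iff_explicit` in absolute value -/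

section TopPair

open T4Continuum Node00
open Summit.QuantumFields.YangMills.BalabanUVNodes.N13DensityOfRecordIsAveragedGibbsMeasureAtRecord13SepCoPH (integrable_rhoZeroOfRecord)
open B15Eq112TorusCover (cover lift cover_lift)
open B15Claim189CubePin (cubeOfSite cubeOfSite_mem_cubeIndices mem_cubeExt_cubeIdx_of_near)
open BalabanUVNodesN11TransportBlockCombGauge (blockOf_ends_of_mem_blockComb exists_treeOrder_blockCombs_avoiding_emb)
open BalabanUVNodesN11BlockCombCard (card_blockCombs)

variable {F : T4Family} {N : ℕ} [NeZero N]

/-- The standing range `0 + 1 ≤ m + K` of the `K`-th torus from `0 < K` (bookkeeping). [folklore] -/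
private theorem one_le_m_add_K {K : ℕ} (hK : 0 < K) : 0 + 1 ≤ (F.P K).m + (F.P K).K := by
  simp only [T4Family.P_K, T4Family.P_m]; omega

/-- **A LEVEL-0 BOND INSIDE A BLOCK IS READ BY THE (3.3) CUBE OF THE BLOCK's CENTRE, AT THE RECORD.**  For the pinned (3.3)∕(3.4) data of record at step `k+1 = 1` (starred
bond sets `(□′^{∼2})^{(0)*}` = the bonds with both ends in `□′^{∼2}`, `StepWeightsOfRecord.sect3DataOfRecord`), a bond whose two ends lie in the block `B(y)` lies in the starred bond
set of the `L²M₂R₁`-cube `□′` containing the centre `emb y` — a block site is within `L` labels of its centre (dag-n11-d's `abs_val_emb_blockOf_sub_le`), and `L ≤ 2·side` puts it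
in `□′^{∼2}` (`mem_cubeEnl_of_val_near_cover`).  Displayed numeric side conditions: `0 < side`, `L ≤ 2·side`. [cite: Balaban1988Convergent, (3.3)–(3.4) p.265; Balaban1987RG1, (0.1)–(0.3) pp.251–252] -/
theorem mem_bondsStar_sect3DataOfRecord_of_blockOf_eq {ν : Stage7Numerics} {M : ℕ} (p : B12.RunParams) (hK : 0 < p.K) (g : ℕ → ℝ)
    (s : SeqOfRecord F ν M g p.K 0) (hside : 0 < sideχ F ν p g 0) (hL : (F.P p.K).L ≤ 2 * sideχ F ν p g 0) {y : Site (F.P p.K) 1}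
    {b : PBond (F.P p.K) 0} (hsrc : blockOf b.src = y) (htgt : blockOf b.tgt = y) :
    b ∈ (sect3DataOfRecord F N ν M p g 0 s).bondsStar
      ⟨cubeOfSite (sideχ F ν p g 0) (emb y), cubeOfSite_mem_cubeIndices (sideχ F ν p g 0) hside (emb y)⟩ := by
  classical
  have hj : 0 + 1 ≤ (F.P p.K).m + (F.P p.K).K := one_le_m_add_K hK
  have hz : lift (F.P p.K) (emb y) ∈ B14.Eq213MaximalDomains.cubeExt (sideχ F ν p g 0) (cubeOfSite (sideχ F ν p g 0) (emb y)) ((0 * sideχ F ν p g 0 : ℕ) : ℤ) :=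
    mem_cubeExt_cubeIdx_of_near (sideχ F ν p g 0) hside _ _ (fun i => ⟨by simp, by simp⟩)
  have key : ∀ t : Site (F.P p.K) 0, blockOf t = y → t ∈ cubeEnl (F.P p.K) (sideχ F ν p g 0) (cubeOfSite (sideχ F ν p g 0) (emb y)) 2 := by
    intro t ht
    refine mem_cubeEnl_of_val_near_cover hz (w := (F.P p.K).L) (fun i => ?_) (by omega)
    rw [cover_lift, abs_sub_comm, ← ht]
    exact abs_val_emb_blockOf_sub_le hj t i
  simp only [sect3DataOfRecord]
  exact Finset.mem_filter.2 ⟨Finset.mem_univ _, key b.src hsrc, key b.tgt htgt⟩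

omit [NeZero N] in
/-- **A RESIDUAL OBEYING THE RECORD'S ROW `Σ_{(R,S)}|ζ| ≤ 1` HAS `|Σ_S ζ(∅,S)| ≤ 1`** (the top pair's weight sums the residual over the labels `(R,S) = (∅,S)` only).
[cite: Balaban1988Convergent, (3.16) p.268, (3.21) p.269 (bookkeeping)] -/
theorem abs_sum_zeta_le_one {ν : Stage7Numerics} {M : ℕ} {ζ : ZetaOfRecord F N ν M} (hζ : IsZetaAbsLeOne F N ν M ζ) (p : B12.RunParams) (g : ℕ → ℝ) (k : ℕ)
    (s : SeqOfRecord F ν M g p.K k) (Pl Ql Rl : Finset (Iχ F ν p g k)) (U : GaugeField (F.P p.K) k (SU N)) (V' : GaugeField (F.P p.K) (k + 1) (SU N)) :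
    |∑ S : Finset (Iχ F ν p g k), ζ p g k s Pl Ql (Rl, S) U V'| ≤ 1 := by
  classical
  have hinj : Function.Injective fun S : Finset (Iχ F ν p g k) => (Rl, S) := fun S S' h => (Prod.mk.inj h).2
  calc |∑ S : Finset (Iχ F ν p g k), ζ p g k s Pl Ql (Rl, S) U V'|
      ≤ ∑ S : Finset (Iχ F ν p g k), |ζ p g k s Pl Ql (Rl, S) U V'| := Finset.abs_sum_le_sum_abs _ _
    _ = ∑ RS ∈ (Finset.univ : Finset (Finset (Iχ F ν p g k))).image (fun S => (Rl, S)), |ζ p g k s Pl Ql RS U V'| := by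
        rw [Finset.sum_image fun S _ S' _ h => hinj h]
    _ ≤ ∑ RS, |ζ p g k s Pl Ql RS U V'| :=
        Finset.sum_le_sum_of_subset_of_nonneg (Finset.subset_univ _) fun RS _ _ => abs_nonneg _
    _ ≤ 1 := hζ p g k s Pl Ql U V'

/-- ★★★ **THE OLD SIDE OF THE TOP PAIR's MAIN TERM IS AT MOST `Haar{|h − 1| < 2δ₀}^{#T}` TIMES THE TRANSPORT OF `ρ₀`, A.E.**  At the Stage-13 record (a run `p` with `0 < K`,
a length-1 history `s′`), for a residual `θ.ζ` obeying the record's row `IsZetaAbsLeOne` (`Provisos₁₃….zetaAbs`), the weight `χ′_0(ALL)·Σ_Sζ_1(∅,∅,(∅,S))` jointly measurable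
(def-T's (O4)), and ANY bond set `T` of `T^{(0)}` with a centre-avoiding peeling order whose bonds are read by the (3.3) cubes of record:
`|∫dU δ(ŪV′⁻¹)[χ′_0(ALL)(U,V′)·Σ_Sζ_1(∅,∅,(∅,S))(U,V′)·ρ₀(U)](V′)| ≤ Haar{|h − 1| < 2δ₀}^{#T} · ∫dU δ(ŪV′⁻¹)[ρ₀](V′)` for `dV′`-a.e. `V′` — the old side of dag-n11-d's
`firstStep_O3_top_iff_explicit` is volume-suppressed against the full transport of `ρ₀ = e^{−E}e^{−A∕g₀²}` at EVERY coarse field, smooth or rough; any new side the identity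
displays must be that small on `{χ₁(s′) ≠ 0}`.  In print this term is the leading one ([III] Thm 1 ∕ [I] Thm 1), read after (1.5)⇒(1.6) ([III] p.265 L.8–12).
[cite: Balaban1988Convergent, (3.1) p.264, (3.3)–(3.4) p.265 with L.8–12, (3.16) p.268, Thm 1 p.262; Balaban1987RG1, (0.13)–(0.16) pp.254–255, (0.19) p.255, Thm 1 p.259] -/
theorem abs_firstStep_oldSide_le_ae (θ : Stage13HParams F N) (p : B12.RunParams) (hK : 0 < p.K) [DecidableEq (PBond (F.P p.K) 0)]
    (s' : SeqOfRecord F θ.ν θ.τ9.M (gOfRecord₁₃ F N θ.toStage13Params p) p.K 1)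
    (hζ : IsZetaAbsLeOne F N θ.ν θ.τ9.M θ.ζ)
    (hm : Measurable fun q : GaugeField (F.P p.K) 0 (SU N) × GaugeField (F.P p.K) 1 (SU N) =>
      chiPrime (sect3DataOfRecord F N θ.ν θ.τ9.M p (gOfRecord₁₃ F N θ.toStage13Params p) 0 s'.init) (avOfRecord F N p.K)
          (2 * deltaOfRecord θ.ν (gOfRecord₁₃ F N θ.toStage13Params p) 0 θ.A₁) (Finset.univ : Finset (Iχ F θ.ν p (gOfRecord₁₃ F N θ.toStage13Params p) 0)) q.1 q.2 *
        ∑ S : Finset (Iχ F θ.ν p (gOfRecord₁₃ F N θ.toStage13Params p) 0), θ.ζ p (gOfRecord₁₃ F N θ.toStage13Params p) 0 s'.init ∅ ∅ (∅, S) q.1 q.2)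
    {T : Finset (PBond (F.P p.K) 0)} {v : PBond (F.P p.K) 0 → Site (F.P p.K) 0} {r : Site (F.P p.K) 0 → ℕ} (hT : TreeOrder T v r)
    (hv : ∀ b ∈ T, ∀ y : Site (F.P p.K) 1, v b ≠ emb y)
    (cT : PBond (F.P p.K) 0 → Iχ F θ.ν p (gOfRecord₁₃ F N θ.toStage13Params p) 0)
    (hcb : ∀ b ∈ T, b ∈ (sect3DataOfRecord F N θ.ν θ.τ9.M p (gOfRecord₁₃ F N θ.toStage13Params p) 0 s'.init).bondsStar (cT b)) :
    ∀ᵐ V' ∂fieldMeasure (F.P p.K) 1 (SU N),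
      |transportOfRecord F N p.K 0 (fun U =>
          chiPrime (sect3DataOfRecord F N θ.ν θ.τ9.M p (gOfRecord₁₃ F N θ.toStage13Params p) 0 s'.init) (avOfRecord F N p.K)
              (2 * deltaOfRecord θ.ν (gOfRecord₁₃ F N θ.toStage13Params p) 0 θ.A₁) (Finset.univ : Finset (Iχ F θ.ν p (gOfRecord₁₃ F N θ.toStage13Params p) 0)) U V' *
            (∑ S : Finset (Iχ F θ.ν p (gOfRecord₁₃ F N θ.toStage13Params p) 0), θ.ζ p (gOfRecord₁₃ F N θ.toStage13Params p) 0 s'.init ∅ ∅ (∅, S) U V') *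
            rhoZeroOfRecord F N p.K (gOfRecord₁₃ F N θ.toStage13Params p 0) (EOfRecord₁₃ F N θ.toStage13Params p) U) V'| ≤
        ((HaarData.haar : Measure (SU N)) {h : SU N | dist1 h < 2 * deltaOfRecord θ.ν (gOfRecord₁₃ F N θ.toStage13Params p) 0 θ.A₁}).toReal ^ T.card *
          transportOfRecord F N p.K 0 (rhoZeroOfRecord F N p.K (gOfRecord₁₃ F N θ.toStage13Params p 0) (EOfRecord₁₃ F N θ.toStage13Params p)) V' := by
  have h := abs_transportOfRecord_chiPrime_mul_le_ae F N hK
    (fineGaugeInvariant_rhoZeroOfRecord F N p.K (gOfRecord₁₃ F N θ.toStage13Params p 0) (EOfRecord₁₃ F N θ.toStage13Params p))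
    (measurable_rhoZeroOfRecord F N p.K (gOfRecord₁₃ F N θ.toStage13Params p 0) (EOfRecord₁₃ F N θ.toStage13Params p))
    (integrable_rhoZeroOfRecord F N p.K (gOfRecord₁₃ F N θ.toStage13Params p 0) (EOfRecord₁₃ F N θ.toStage13Params p))
    (fun U => (rhoZeroOfRecord_pos F N p.K (gOfRecord₁₃ F N θ.toStage13Params p 0) (EOfRecord₁₃ F N θ.toStage13Params p) U).le)
    (sect3DataOfRecord F N θ.ν θ.τ9.M p (gOfRecord₁₃ F N θ.toStage13Params p) 0 s'.init) (avOfRecord F N p.K)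
    (2 * deltaOfRecord θ.ν (gOfRecord₁₃ F N θ.toStage13Params p) 0 θ.A₁) Finset.univ hT hv cT (fun _ _ => Finset.mem_univ _) hcb
    (w := fun U V' => ∑ S : Finset (Iχ F θ.ν p (gOfRecord₁₃ F N θ.toStage13Params p) 0), θ.ζ p (gOfRecord₁₃ F N θ.toStage13Params p) 0 s'.init ∅ ∅ (∅, S) U V')
    hm (C := 1) (fun U V' => abs_sum_zeta_le_one hζ p _ 0 s'.init ∅ ∅ ∅ U V')
  filter_upwards [h] with V' hV'
  rwa [one_mul] at hV'

/-- ★★★ **THE SAME WITH THE BLOCK-COMB FOREST OF ANY `Y ⊆ T^{(1)}`: `|old side(V′)| ≤ Haar{|h − 1| < 2δ₀}^{|Y|·(L^d − 1)} · transportOfRecord 0 ρ₀ V′` FOR A.E. `V′`** — every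
comb bond is read by the (3.3) cube of its own block's centre (numeric side conditions `0 < side`, `L ≤ 2·side` on the `L²M₂R₁`-cubes displayed); `Y = univ` is the whole torus:
the old side of the top pair is suppressed EXPONENTIALLY IN THE VOLUME against the transport of `ρ₀`, at every coarse field (at `N = 2`, `2δ₀ ≤ 1`: by at most
`(π²(2δ₀)³∕12)^{|T^{(1)}|·(L^d − 1)}`, §3).  Whatever new side dag-n11-d's `firstStep_O3_top_iff_explicit` displays is that small wherever the identity holds.
[cite: Balaban1988Convergent, (3.1) p.264, (3.3)–(3.4) p.265 with L.8–12, Thm 1 p.262; Balaban1987RG1, (0.13)–(0.16) pp.254–255, (0.19) p.255, Thm 1 p.259] -/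
theorem abs_firstStep_oldSide_le_ae_blockCombs (θ : Stage13HParams F N) (p : B12.RunParams) (hK : 0 < p.K) [DecidableEq (PBond (F.P p.K) 0)]
    (s' : SeqOfRecord F θ.ν θ.τ9.M (gOfRecord₁₃ F N θ.toStage13Params p) p.K 1)
    (hζ : IsZetaAbsLeOne F N θ.ν θ.τ9.M θ.ζ)
    (hm : Measurable fun q : GaugeField (F.P p.K) 0 (SU N) × GaugeField (F.P p.K) 1 (SU N) =>
      chiPrime (sect3DataOfRecord F N θ.ν θ.τ9.M p (gOfRecord₁₃ F N θ.toStage13Params p) 0 s'.init) (avOfRecord F N p.K)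
          (2 * deltaOfRecord θ.ν (gOfRecord₁₃ F N θ.toStage13Params p) 0 θ.A₁) (Finset.univ : Finset (Iχ F θ.ν p (gOfRecord₁₃ F N θ.toStage13Params p) 0)) q.1 q.2 *
        ∑ S : Finset (Iχ F θ.ν p (gOfRecord₁₃ F N θ.toStage13Params p) 0), θ.ζ p (gOfRecord₁₃ F N θ.toStage13Params p) 0 s'.init ∅ ∅ (∅, S) q.1 q.2)
    (hside : 0 < sideχ F θ.ν p (gOfRecord₁₃ F N θ.toStage13Params p) 0) (hL : (F.P p.K).L ≤ 2 * sideχ F θ.ν p (gOfRecord₁₃ F N θ.toStage13Params p) 0)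
    (Y : Finset (Site (F.P p.K) 1)) :
    ∀ᵐ V' ∂fieldMeasure (F.P p.K) 1 (SU N),
      |transportOfRecord F N p.K 0 (fun U =>
          chiPrime (sect3DataOfRecord F N θ.ν θ.τ9.M p (gOfRecord₁₃ F N θ.toStage13Params p) 0 s'.init) (avOfRecord F N p.K)
              (2 * deltaOfRecord θ.ν (gOfRecord₁₃ F N θ.toStage13Params p) 0 θ.A₁) (Finset.univ : Finset (Iχ F θ.ν p (gOfRecord₁₃ F N θ.toStage13Params p) 0)) U V' *
            (∑ S : Finset (Iχ F θ.ν p (gOfRecord₁₃ F N θ.toStage13Params p) 0), θ.ζ p (gOfRecord₁₃ F N θ.toStage13Params p) 0 s'.init ∅ ∅ (∅, S) U V') *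
            rhoZeroOfRecord F N p.K (gOfRecord₁₃ F N θ.toStage13Params p 0) (EOfRecord₁₃ F N θ.toStage13Params p) U) V'| ≤
        ((HaarData.haar : Measure (SU N)) {h : SU N | dist1 h < 2 * deltaOfRecord θ.ν (gOfRecord₁₃ F N θ.toStage13Params p) 0 θ.A₁}).toReal ^
            (Y.card * ((F.P p.K).L ^ (F.P p.K).d - 1)) *
          transportOfRecord F N p.K 0 (rhoZeroOfRecord F N p.K (gOfRecord₁₃ F N θ.toStage13Params p 0) (EOfRecord₁₃ F N θ.toStage13Params p)) V' := by
  have hj : 0 + 1 ≤ (F.P p.K).m + (F.P p.K).K := one_le_m_add_K hK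
  obtain ⟨v, r, hT, hv⟩ := exists_treeOrder_blockCombs_avoiding_emb hj Y
  rw [← card_blockCombs (P := F.P p.K) (j := 0) hj Y]
  refine abs_firstStep_oldSide_le_ae θ p hK s' hζ hm hT hv
    (fun b => ⟨cubeOfSite (sideχ F θ.ν p (gOfRecord₁₃ F N θ.toStage13Params p) 0) (emb (blockOf b.src)),
      cubeOfSite_mem_cubeIndices _ hside _⟩) fun b hb => ?_
  obtain ⟨y, -, hby⟩ := Finset.mem_biUnion.1 hb
  obtain ⟨hsrc, htgt⟩ := blockOf_ends_of_mem_blockComb hj y hby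
  exact mem_bondsStar_sect3DataOfRecord_of_blockOf_eq (N := N) p hK _ s'.init hside hL rfl (htgt.trans hsrc.symm)

end TopPair

end Summit.QuantumFields.YangMills.Theorems.BalabanUVNodesN11ChiPrimeFineOrbitAverageBoundTransport

end
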